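import Mathlib.AlgebraicGeometry.Morphisms.Proper
import Mathlib.AlgebraicGeometry.Morphisms.FiniteType
import Mathlib.AlgebraicGeometry.Morphisms.QuasiSeparated
import Mathlib.AlgebraicGeometry.Morphisms.Immersion
import Mathlib.AlgebraicGeometry.Morphisms.SchemeTheoreticallyDominant
import Literature.AlgebraicGeometry.Resolution.ChowLemmaProofs
import Literature.AlgebraicGeometry.Resolution.ChowLemmaGeneralProofs
import Literature.AlgebraicGeometry.Limits.FiniteTypeModel
import HarnessLib

/-!
# Nagata's compactification theorem (named fact)

Topic: `Literature/AlgebraicGeometry/Morphisms`. The statement of Nagata's theorem that a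
separated morphism of finite type to a quasi-compact quasi-separated scheme factors as an open
immersion followed by a proper morphism (Nagata 1962/63 for varieties and Noetherian schemes;
Deligne's proof written up by Conrad 2007, Thm. 4.1, for qcqs bases; Lütkebohmert 1993;
The Stacks Project, Tag 0F41). It is recorded as a NAMED FACT `NagataCompactification`
(`def … : Prop`, users take `(h : NagataCompactification)`); nothing is proved here. The
scheme-theoretic density refinement ("`j` may be taken schematically dense", Conrad 2007,
Thm. 4.1 / Stacks 0ATU) is deliberately NOT part of the statement: a user needing a dense
compactification replaces `X̄` by the scheme-theoretic image of `j` (Mathlib `Scheme.Hom.image`).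

## References

* M. Nagata, *Imbedding of an abstract variety in a complete variety*, J. Math. Kyoto Univ. 2
  (1962) 1–10. [Nagata1962]
* B. Conrad, *Deligne's notes on Nagata compactifications*, J. Ramanujan Math. Soc. 22 (2007)
  205–257, Thm. 4.1. [Conrad2007]
* W. Lütkebohmert, *On compactification of schemes*, Manuscripta Math. 80 (1993) 95–111.
  [Lutkebohmert1993]
* The Stacks Project, Tag 0F41. [StacksProject]
-/

noncomputable section

open CategoryTheory AlgebraicGeometry

namespace Literature.AlgebraicGeometry.Morphisms

universe u

/-- NAMED FACT — **Nagata's compactification theorem** (Conrad 2007, Thm. 4.1: "Let `S` be a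
quasi-compact and quasi-separated scheme and `f : X → S` a separated map of finite type. There is
an open immersion `j : X ↪ X̄` over `S` into a proper `S`-scheme"; Stacks, Tag 0F41): for every
quasi-compact quasi-separated scheme `S` and every separated morphism of finite type
`f : X → S` there are a scheme `X̄`, an open immersion `j : X → X̄` and a proper morphism
`g : X̄ → S` with `j ≫ g = f`. Users take `(h : NagataCompactification)`.
[cite: Conrad2007, Thm. 4.1] -/
def NagataCompactification : Prop :=
  ∀ (X S : Scheme.{u}) (f : X ⟶ S) [CompactSpace S] [QuasiSeparatedSpace S]
    [IsSeparated f] [LocallyOfFiniteType f] [QuasiCompact f],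
    ∃ (Xc : Scheme.{u}) (j : X ⟶ Xc) (g : Xc ⟶ S), IsOpenImmersion j ∧ IsProper g ∧ j ≫ g = f

/-- The trivial instance: a PROPER morphism is its own compactification (`j = 𝟙`), so the fact is
only about non-proper `f`. [folklore] -/
theorem nagataCompactification_of_isProper {X S : Scheme.{u}} (f : X ⟶ S) [IsProper f] :
    ∃ (Xc : Scheme.{u}) (j : X ⟶ Xc) (g : Xc ⟶ S),
      IsOpenImmersion j ∧ IsProper g ∧ j ≫ g = f :=
  ⟨X, 𝟙 X, f, inferInstance, inferInstance, Category.id_comp f⟩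

/-! ## Proved fragments of Conrad's proof of Theorem 4.1

The two closing paragraphs of the proof of [Conrad 2007, Thm. 4.1] (p. 31) and Remark 4.2 are
formal bookkeeping on Mathlib's scheme-theoretic image and are PROVED here; the body of the proof
(§§1–3: blow-ups and strict transforms, quasi-dominations, Thm. 2.4, Cor. 2.6, Thm. 2.8, Cor. 2.10,
Lemmas 3.1–3.2, the gluing of §4, Thm. 4.3 and the Thomason–Trobaugh approximation) is not. -/

open CategoryTheory.Limits

/-- **An `S`-scheme with a quasi-compact immersion into a proper `S`-scheme is compactifiable**
(Conrad 2007, proof of Thm. 4.1, last paragraph, p. 31: "the composite map `k : X → X̄′` is an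
immersion into a proper `S`-scheme. Since `k` is quasi-compact, it must factor as an open
immersion into a closed subscheme of `X̄′`; this gives the desired compactification for `X` over
`S`"). The factorisation is `X → im(k) ↪ P → S` through the scheme-theoretic image (Mathlib: a
quasi-compact immersion is an open immersion onto its scheme-theoretic image, whose inclusion is
a closed immersion, hence proper). In particular every `S`-scheme that is quasi-projective in the
sense of an immersion into some proper (e.g. projective) `S`-scheme is compactifiable.
[cite: Conrad2007, proof of Thm. 4.1 (p. 31)] -/
theorem exists_compactification_of_immersion {X P S : Scheme.{u}} (k : X ⟶ P) (p : P ⟶ S)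
    [IsImmersion k] [QuasiCompact k] [IsProper p] :
    ∃ (Xc : Scheme.{u}) (j : X ⟶ Xc) (g : Xc ⟶ S),
      IsOpenImmersion j ∧ IsProper g ∧ j ≫ g = k ≫ p :=
  ⟨k.image, k.toImage, k.imageι ≫ p, inferInstance, inferInstance,
    by rw [k.toImage_imageι_assoc]⟩

/-- **Compactifications base-change** (the step "applying base change gives an open immersion of
`X` into the proper `S`-scheme `X̄_{i₀} ×_{S_{i₀}} S`" in Conrad's reduction of Thm. 4.1 to the
Noetherian case, p. 31): if `f : X → S` factors as an open immersion followed by a proper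
morphism, then so does its base change `X ×_S T → T` along any `t : T → S` (open immersions and
proper morphisms are stable under base change; pasting of pull-back squares).
[cite: Conrad2007, proof of Thm. 4.1 (p. 31)] -/
theorem exists_compactification_pullback_snd {X S T : Scheme.{u}} (f : X ⟶ S) (t : T ⟶ S)
    (h : ∃ (Xc : Scheme.{u}) (j : X ⟶ Xc) (g : Xc ⟶ S),
      IsOpenImmersion j ∧ IsProper g ∧ j ≫ g = f) :
    ∃ (Yc : Scheme.{u}) (j' : pullback f t ⟶ Yc) (g' : Yc ⟶ T),
      IsOpenImmersion j' ∧ IsProper g' ∧ j' ≫ g' = pullback.snd f t := by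
  obtain ⟨Xc, j, g, hj, hg, rfl⟩ := h
  refine ⟨pullback g t, (pullbackRightPullbackFstIso g t j).inv ≫ pullback.snd j (pullback.fst g t),
    pullback.snd g t, inferInstance, inferInstance, ?_⟩
  simp only [Category.assoc, pullbackRightPullbackFstIso_inv_snd_snd]

/-- **Schematically dense refinement** (Conrad 2007, Remark 4.2: "Since `X → S` is quasi-compact
and `X̄ → S` is separated, any `j : X ↪ X̄` as in Theorem 4.1 is necessarily quasi-compact. Thus,
a scheme-theoretic closure of `X` in `X̄` exists and if we rename this as `X̄` then we obtain a
`j` that is also schematically dense"; Stacks 0ATU/0F41). From the named fact: every separated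
morphism of finite type to a qcqs scheme factors as a dominant, scheme-theoretically dominant
open immersion followed by a proper morphism (scheme-theoretic dominance of `X → im(j)`:
`Literature.AlgebraicGeometry.Resolution.ChowLemmaProof.isSchemeTheoreticallyDominant_toImage`).
[cite: Conrad2007, Remark 4.2] -/
theorem NagataCompactification.exists_dense (hN : NagataCompactification.{u}) (X S : Scheme.{u})
    (f : X ⟶ S) [CompactSpace S] [QuasiSeparatedSpace S] [IsSeparated f] [LocallyOfFiniteType f]
    [QuasiCompact f] :
    ∃ (Xc : Scheme.{u}) (j : X ⟶ Xc) (g : Xc ⟶ S), IsOpenImmersion j ∧ IsDominant j ∧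
      IsSchemeTheoreticallyDominant j ∧ IsProper g ∧ j ≫ g = f := by
  obtain ⟨Xc, j, g, hj, hg, hfac⟩ := hN X S f
  -- `j` is quasi-compact: `j ≫ g = f` is and `g` is (quasi-)separated
  haveI : QuasiCompact (j ≫ g) := hfac ▸ inferInstance
  haveI : QuasiCompact j := .of_comp j g
  haveI := Resolution.ChowLemmaProof.isSchemeTheoreticallyDominant_toImage j
  exact ⟨j.image, j.toImage, j.imageι ≫ g, inferInstance, inferInstance, inferInstance,
    inferInstance, by rw [j.toImage_imageι_assoc, hfac]⟩

/-! ## The first step of the Noetherian case over a field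

The Stacks Project's proof of Nagata's theorem (Tag 0F41, Noetherian case) starts: "We can
choose a finite affine open covering `X = ⋃ Uᵢ` such that `U₁ ∩ … ∩ Uₙ` is dense in `X`. […] For
each `i` we can choose an `nᵢ ≥ 0` and an immersion `Uᵢ → 𝐀^{nᵢ}_S`. Hence `Uᵢ` has a
compactification over `S` for `i = 1, …, n` by taking the scheme theoretic image in `𝐏^{nᵢ}_S`."
Over a field this step is available now. -/

/-- **Affine schemes of finite type over a field are compactifiable** (The Stacks Project,
Tag 0F41, proof, Noetherian case, first step, for `S = Spec k`): an affine `X` of finite type over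
`k` admits a `k`-immersion into some `𝐏ⁿ_k`
(`Literature.AlgebraicGeometry.Resolution.ChowLemmaProof.exists_immersion_projectiveSpace`),
which is quasi-compact, and `𝐏ⁿ_k → Spec k` is proper, so `exists_compactification_of_immersion`
applies. [cite: StacksProject, Tag 0F41 (proof, Noetherian case)] -/
theorem exists_compactification_of_isAffine_of_field (k : Type u) [Field k] (X : Scheme.{u})
    [IsAffine X] (f : X ⟶ Spec (.of k)) [LocallyOfFiniteType f] :
    ∃ (Xc : Scheme.{u}) (j : X ⟶ Xc) (g : Xc ⟶ Spec (.of k)),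
      IsOpenImmersion j ∧ IsProper g ∧ j ≫ g = f := by
  obtain ⟨n, ρ, hρ, hρf⟩ := Resolution.ChowLemmaProof.exists_immersion_projectiveSpace k f
  haveI := hρ
  haveI : IsProper (Motives.projectiveSpace n k).hom := Motives.isProper_projectiveSpace n k
  -- `ρ` is quasi-compact: `ρ ≫ (𝐏ⁿ_k → Spec k) = f` is (`X` is quasi-compact) and `𝐏ⁿ_k → Spec k`
  -- is separated
  haveI : QuasiCompact (ρ ≫ (Motives.projectiveSpace n k).hom) := hρf ▸ inferInstance
  haveI : QuasiCompact ρ := .of_comp ρ (Motives.projectiveSpace n k).hom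
  obtain ⟨Xc, j, g, hj, hg, hfac⟩ :=
    exists_compactification_of_immersion ρ (Motives.projectiveSpace n k).hom
  exact ⟨Xc, j, g, hj, hg, hfac.trans hρf⟩

/-- Hence **every scheme admitting a quasi-compact immersion over `k` into an affine scheme of
finite type over a field `k`** (e.g. a quasi-affine `k`-scheme of finite type, or an open
subscheme of an affine `k`-variety) **is compactifiable over `k`**: compose with a
compactification of the affine scheme and take the scheme-theoretic image again.
[cite: StacksProject, Tag 0F41 (proof, Noetherian case)] -/
theorem exists_compactification_of_immersion_into_isAffine_of_field (k : Type u) [Field k]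
    {X Y : Scheme.{u}} [IsAffine Y] (i : X ⟶ Y) [IsImmersion i] [QuasiCompact i]
    (f : Y ⟶ Spec (.of k)) [LocallyOfFiniteType f] :
    ∃ (Xc : Scheme.{u}) (j : X ⟶ Xc) (g : Xc ⟶ Spec (.of k)),
      IsOpenImmersion j ∧ IsProper g ∧ j ≫ g = i ≫ f := by
  obtain ⟨Yc, jY, gY, hjY, hgY, hfacY⟩ := exists_compactification_of_isAffine_of_field k Y f
  haveI := hjY
  haveI := hgY
  haveI : QuasiCompact (jY ≫ gY) := hfacY ▸ inferInstance
  haveI : QuasiCompact jY := .of_comp jY gY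
  obtain ⟨Xc, j, g, hj, hg, hfac⟩ := exists_compactification_of_immersion (i ≫ jY) gY
  exact ⟨Xc, j, g, hj, hg, by rw [hfac, Category.assoc, hfacY]⟩


/-! ## APPENDIX (session 2): assembling the Noetherian case of Stacks 0F41 from its two inputs

The Stacks Project, Tag 0F41, proof, Noetherian case: "Assume `S` is Noetherian. We can choose a
finite affine open covering `X = ⋃_{i=1,…,n} Uᵢ` such that `U₁ ∩ … ∩ Uₙ` is dense in `X`. This
follows from Properties, Lemma 30.4 and the fact that `X` is quasi-compact with finitely many
irreducible components. For each `i` […] `Uᵢ` has a compactification over `S` […]. Applying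
Lemma 33.7 [Tag 0F40] `(n − 1)` times we conclude that the theorem is true."

Below, this induction is carried out once and for all, with its two inputs as hypotheses on the
base `S`: (a) affine schemes of finite type over `S` are compactifiable (PROVED for every `S` in
`Literature/AlgebraicGeometry/Morphisms/AffineSpaceCompactification.lean`,
`exists_compactification_of_isAffine`), and (b) the two-piece lemma Tag 0F40 as printed ("Let
`U` be a scheme of finite type and separated over `S`. Let `U = U₁ ∪ U₂` be opens such that `U₁`
and `U₂` have compactifications over `S` and such that `U₁ ∩ U₂` is dense in `U`. Then `U` has a
compactification over `S`"), whose proof from Raynaud–Gruson flattening (Tags 081R/081S, 0F3V,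
0F3W, 0F3X, 0F3Y, 0F3Z, 0F3U, 0894) is the remaining literature debt of this route. The dense
affine cover is `Resolution.ChowLemmaProof.exists_affine_cover_dense_iInf_of_isNoetherian`
(Stacks 0200/0BA8). Nothing here is a named fact: the hypotheses are discharged by the caller. -/

section Assembly

variable {S : Scheme.{u}}

/-- An open subscheme of a compactifiable `S`-scheme is compactifiable (compose the open
immersions; compactifications are not required to be dense). [folklore] -/
theorem exists_compactification_of_isOpenImmersion_comp {A B : Scheme.{u}} (i : A ⟶ B)
    [IsOpenImmersion i] (g : B ⟶ S)
    (hB : ∃ (Bc : Scheme.{u}) (j : B ⟶ Bc) (h : Bc ⟶ S), IsOpenImmersion j ∧ IsProper h ∧ j ≫ h = g) :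
    ∃ (Ac : Scheme.{u}) (j : A ⟶ Ac) (h : Ac ⟶ S), IsOpenImmersion j ∧ IsProper h ∧ j ≫ h = i ≫ g := by
  obtain ⟨Bc, j, h, hj, hh, rfl⟩ := hB
  exact ⟨Bc, i ≫ j, h, inferInstance, hh, Category.assoc _ _ _⟩

/-- If the open immersion `A ↪ X` has image inside the open `W ⊆ X` and `W → S` is
compactifiable, then `A → S` is compactifiable. [folklore] -/
theorem exists_compactification_of_range_subset {A X : Scheme.{u}} (i : A ⟶ X) [IsOpenImmersion i]
    (f : X ⟶ S) (W : X.Opens) (hAW : Set.range i ⊆ (W : Set X))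
    (hW : ∃ (Wc : Scheme.{u}) (j : ↑W ⟶ Wc) (h : Wc ⟶ S),
      IsOpenImmersion j ∧ IsProper h ∧ j ≫ h = W.ι ≫ f) :
    ∃ (Ac : Scheme.{u}) (j : A ⟶ Ac) (h : Ac ⟶ S), IsOpenImmersion j ∧ IsProper h ∧ j ≫ h = i ≫ f := by
  have hAW' : Set.range i ⊆ Set.range W.ι := by rwa [Scheme.Opens.range_ι]
  haveI : IsOpenImmersion (IsOpenImmersion.lift W.ι i hAW' ≫ W.ι) := by
    rw [IsOpenImmersion.lift_fac]
    infer_instance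
  haveI : IsOpenImmersion (IsOpenImmersion.lift W.ι i hAW') := IsOpenImmersion.of_comp _ W.ι
  obtain ⟨Ac, j, h, hj, hh, hfac⟩ :=
    exists_compactification_of_isOpenImmersion_comp (IsOpenImmersion.lift W.ι i hAW') (W.ι ≫ f) hW
  exact ⟨Ac, j, h, hj, hh, by rw [hfac, IsOpenImmersion.lift_fac_assoc]⟩

/-- **The Noetherian case of Nagata's theorem from its two inputs** (Stacks 0F41, proof,
Noetherian case — the induction, carried out): let `X` be a Noetherian scheme and `f : X → S`
separated and locally of finite type. Assume (a) every AFFINE open `U ⊆ X` is compactifiable over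
`S` (true over every `S`, `exists_compactification_of_isAffine` in
`AffineSpaceCompactification.lean`), and (b) the two-piece lemma Stacks 0F40 for the opens of
`X`: if `W = W₁ ∪ W₂ ⊆ X` with `W₁ ∩ W₂` dense in `W` and `W₁ → S`, `W₂ → S` compactifiable, then
`W → S` is compactifiable. Then `f` has a compactification. Proof as printed: a finite affine open
cover `U₀, …, Uₘ` with `⋂ Uᵢ` dense (`exists_affine_cover_dense_iInf_of_isNoetherian`), and
induction on `k` for `Vₖ = U₀ ∪ … ∪ Uₖ` ("applying Lemma 33.7 `(n − 1)` times"), the overlap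
`Vₖ ∩ Uₖ₊₁ ⊇ ⋂ Uᵢ` being dense. [cite: StacksProject, Tag 0F41 (proof, Noetherian case)] -/
theorem exists_compactification_of_isNoetherian_of_twoPiece {X : Scheme.{u}} [IsNoetherian X]
    (f : X ⟶ S) [IsSeparated f] [LocallyOfFiniteType f]
    (hAff : ∀ (U : X.Opens), IsAffineOpen U →
      ∃ (Uc : Scheme.{u}) (j : ↑U ⟶ Uc) (h : Uc ⟶ S), IsOpenImmersion j ∧ IsProper h ∧ j ≫ h = U.ι ≫ f)
    (h0F40 : ∀ (W W₁ W₂ : X.Opens), W₁ ⊔ W₂ = W →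
      Dense (W.ι ⁻¹' ((W₁ ⊓ W₂ : X.Opens) : Set X)) →
      (∃ (Wc : Scheme.{u}) (j : ↑W₁ ⟶ Wc) (h : Wc ⟶ S), IsOpenImmersion j ∧ IsProper h ∧ j ≫ h = W₁.ι ≫ f) →
      (∃ (Wc : Scheme.{u}) (j : ↑W₂ ⟶ Wc) (h : Wc ⟶ S), IsOpenImmersion j ∧ IsProper h ∧ j ≫ h = W₂.ι ≫ f) →
      ∃ (Wc : Scheme.{u}) (j : ↑W ⟶ Wc) (h : Wc ⟶ S), IsOpenImmersion j ∧ IsProper h ∧ j ≫ h = W.ι ≫ f) :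
    ∃ (Xc : Scheme.{u}) (j : X ⟶ Xc) (g : Xc ⟶ S), IsOpenImmersion j ∧ IsProper g ∧ j ≫ g = f := by
  obtain ⟨m, U, hUaff, hUcov, -, hUdense⟩ :=
    Resolution.ChowLemmaProof.exists_affine_cover_dense_iInf_of_isNoetherian X
  -- `V k = U₀ ∪ … ∪ U_k`
  let V : ℕ → X.Opens := fun k => ⨆ (i : Fin (m + 1)) (_ : (i : ℕ) ≤ k), U i
  have hUV : ∀ (k : ℕ) (i : Fin (m + 1)), (i : ℕ) ≤ k → U i ≤ V k := fun k i hi =>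
    le_iSup₂ (f := fun (i : Fin (m + 1)) (_ : (i : ℕ) ≤ k) => U i) i hi
  have hV0 : V 0 ≤ U 0 := iSup₂_le fun i hi => by
    rw [show i = 0 from Fin.ext (Nat.le_zero.mp hi)]
  -- the induction
  have key : ∀ k : ℕ, ∃ (Vc : Scheme.{u}) (j : ↑(V k) ⟶ Vc) (h : Vc ⟶ S),
      IsOpenImmersion j ∧ IsProper h ∧ j ≫ h = (V k).ι ≫ f := by
    intro k
    induction k with
    | zero =>
      exact exists_compactification_of_range_subset (V 0).ι f (U 0)
        (by rw [Scheme.Opens.range_ι]; exact hV0) (hAff (U 0) (hUaff 0))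
    | succ k ih =>
      by_cases hk : k + 1 ≤ m
      · -- `V (k+1) = V k ∪ U (k+1)` with dense overlap
        set i₁ : Fin (m + 1) := ⟨k + 1, Nat.lt_succ_of_le hk⟩ with hi₁
        have hsup : V k ⊔ U i₁ = V (k + 1) := by
          apply le_antisymm
          · exact sup_le (iSup₂_le fun i hi => hUV (k + 1) i (Nat.le_succ_of_le hi))
              (hUV (k + 1) i₁ le_rfl)
          · refine iSup₂_le fun i hi => ?_
            rcases Nat.lt_or_eq_of_le hi with h | h
            · exact (hUV k i (Nat.lt_succ_iff.mp h)).trans le_sup_left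
            · have : i = i₁ := Fin.ext h
              rw [this]
              exact le_sup_right
        refine h0F40 (V (k + 1)) (V k) (U i₁) hsup ?_ ih (hAff (U i₁) (hUaff i₁))
        -- density of the overlap: it contains the dense `⋂ Uᵢ`
        have hsub : ((⨅ i, U i : X.Opens) : Set X) ⊆ ((V k ⊓ U i₁ : X.Opens) : Set X) := by
          intro x hx
          rw [TopologicalSpace.Opens.coe_iInf, Set.mem_iInter] at hx
          exact ⟨hUV k 0 (Nat.zero_le k) (hx 0), hx i₁⟩
        exact ((hUdense.mono hsub).preimage (V (k + 1)).ι.isOpenEmbedding.isOpenMap)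
      · -- beyond `m` the union does not grow
        have hVeq : V (k + 1) = V k := by
          apply le_antisymm
          · refine iSup₂_le fun i hi => hUV k i ?_
            have := i.2
            omega
          · exact iSup₂_le fun i hi => hUV (k + 1) i (Nat.le_succ_of_le hi)
        rw [hVeq]
        exact ih
  -- `V m = X`
  have hVm : V m = ⊤ := top_le_iff.mp (hUcov ▸ iSup_le fun i => hUV m i (Nat.lt_succ_iff.mp i.2))
  obtain ⟨Xc, j, g, hj, hg, hfac⟩ := exists_compactification_of_range_subset (𝟙 X) f (V m)
    (by rw [hVm]; exact fun _ _ => trivial) (key m)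
  exact ⟨Xc, j, g, hj, hg, by rw [hfac, Category.id_comp]⟩

/-- **Nagata's theorem over an arbitrary AFFINE base from the Noetherian case** (the reduction
"We first reduce to the Noetherian case" of Stacks 0F41 / Conrad 2007 Thm. 4.3 + [TT, C.9], in the
affine-base situation where absolute Noetherian approximation is the tree's
`Literature.AlgebraicGeometry.Limits.exists_finiteTypeModel`, Stacks 09ZP/01ZA): let `B` be any ring
and `g : Y → Spec B` separated and of finite type. By Tag 09ZP there are a Noetherian subring
`A₀ ⊆ B`, a separated `Y₀ → Spec A₀` of finite type and a closed `B`-immersion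
`Y ↪ Y₀ ×_{A₀} Spec B`; a compactification of the Noetherian `Y₀` over `Spec A₀` — obtained from
the two inputs of `exists_compactification_of_isNoetherian_of_twoPiece`, here assumed for all
Noetherian schemes over `Spec A₀`-like bases — base-changes to one of `Y₀ ×_{A₀} Spec B`
(`exists_compactification_pullback_snd`), into which `Y` is quasi-compactly immersed
(`exists_compactification_of_immersion`). The two hypotheses are (a) affine schemes of finite
type are compactifiable (all bases; `AffineSpaceCompactification.lean`) and (b) Stacks 0F40 for
Noetherian total spaces. [cite: StacksProject, Tag 0F41 (proof, reduction to the Noetherian case)]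
[cite: Conrad2007, Thm. 4.1 (proof, last two paragraphs) and Thm. 4.3] -/
theorem exists_compactification_affineBase_of_twoPiece
    (hAff : ∀ ⦃S U : Scheme.{u}⦄ [IsAffine U] (g : U ⟶ S) [LocallyOfFiniteType g] [QuasiCompact g],
      ∃ (Uc : Scheme.{u}) (j : U ⟶ Uc) (h : Uc ⟶ S), IsOpenImmersion j ∧ IsProper h ∧ j ≫ h = g)
    (h0F40 : ∀ ⦃S X : Scheme.{u}⦄ [IsNoetherian X] (f : X ⟶ S) [IsSeparated f] [LocallyOfFiniteType f]
      (W W₁ W₂ : X.Opens), W₁ ⊔ W₂ = W → Dense (W.ι ⁻¹' ((W₁ ⊓ W₂ : X.Opens) : Set X)) →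
      (∃ (Wc : Scheme.{u}) (j : ↑W₁ ⟶ Wc) (h : Wc ⟶ S), IsOpenImmersion j ∧ IsProper h ∧ j ≫ h = W₁.ι ≫ f) →
      (∃ (Wc : Scheme.{u}) (j : ↑W₂ ⟶ Wc) (h : Wc ⟶ S), IsOpenImmersion j ∧ IsProper h ∧ j ≫ h = W₂.ι ≫ f) →
      ∃ (Wc : Scheme.{u}) (j : ↑W ⟶ Wc) (h : Wc ⟶ S), IsOpenImmersion j ∧ IsProper h ∧ j ≫ h = W.ι ≫ f)
    {B : Type u} [CommRing B] {Y : Scheme.{u}} (g : Y ⟶ Spec (.of B)) [IsSeparated g]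
    [LocallyOfFiniteType g] [QuasiCompact g] :
    ∃ (Yc : Scheme.{u}) (j : Y ⟶ Yc) (h : Yc ⟶ Spec (.of B)), IsOpenImmersion j ∧ IsProper h ∧ j ≫ h = g := by
  obtain ⟨A₀, _, φ, Y₀, p, j, hA₀, -, -, hp₁, hp₂, hp₃, hj, hjg⟩ := Literature.AlgebraicGeometry.Limits.exists_finiteTypeModel g
  haveI := hp₁
  haveI := hp₂
  haveI := hp₃
  haveI := hj
  -- `Y₀` is Noetherian: of finite type over the Noetherian `Spec A₀`
  haveI : IsNoetherianRing (CommRingCat.of A₀) := hA₀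
  haveI : IsLocallyNoetherian Y₀ := LocallyOfFiniteType.isLocallyNoetherian p
  haveI : CompactSpace Y₀ := QuasiCompact.compactSpace_of_compactSpace p
  haveI : IsNoetherian Y₀ := { }
  -- compactify `Y₀ → Spec A₀`
  obtain hY₀ := exists_compactification_of_isNoetherian_of_twoPiece p
    (fun U hU => by haveI : IsAffine U := hU; exact hAff (U.ι ≫ p)) (h0F40 p)
  -- base change to `Spec B`, then the closed immersion `Y ↪ Y₀ ×_{A₀} Spec B`
  obtain ⟨Zc, j', h', hj', hh', hfac⟩ :=
    exists_compactification_pullback_snd p (Spec.map (CommRingCat.ofHom φ)) hY₀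
  haveI := hj'
  haveI := hh'
  haveI : QuasiCompact (j' ≫ h') := hfac ▸ inferInstance
  haveI : QuasiCompact j' := .of_comp j' h'
  obtain ⟨Yc, k, h, hk, hh, hkh⟩ := exists_compactification_of_immersion (j ≫ j') h'
  exact ⟨Yc, k, h, hk, hh, by rw [hkh, Category.assoc, hfac, hjg]⟩

end Assembly

end Literature.AlgebraicGeometry.Morphisms

end
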